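import Summits.ResolutionOfSingularities.ResolutionOfSingularities.Theorems.PurelyInseparableDim4ResConeSwapCone
import Summits.ResolutionOfSingularities.ResolutionOfSingularities.Theorems.PurelyInseparableDim4ShadeTwoSwapRead
import Summits.ResolutionOfSingularities.ResolutionOfSingularities.Theorems.PurelyInseparableDim4ResConeLayer
import HarnessLib
import HarnessLib.Audit.Tags

/-!
# Purely inseparable four-folds — THE SWAP PARTNER OF A ROTATION STEP: the virtual slot child `B = step_a(τ e_f) s` of a
# real rotation child `A = step_f(τ′ e_a) s` (`τ τ′ = 1`) is a diagonal re-presentation of `A`; order, isolation, boundary,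
# power cone and `e_G` of `B` from those of `A` (cell `res-dim4-pi`, K2(p) lane, slice B brick K24a, R1 part «partner»)

[OURS · counted 0 · cell `res-dim4-pi` · K2(p) lane (holder res-dim4-p-12 g3; K24a-R1′ of record 2026-08-29 04:06Z); seat
res-dim4-p-1 g4 over res-dim4-p-7 g3's SN1 `…SwapIdentity` (`swap_step_F_mem`, `swap_step_r`, `exists_inv_mod_X_pow`), SN4a
`SwapNorm.read_of_rel`, and `…ResConeSwapCone`.]  Nothing here proves K2(p)/K2(5), `NoIsolatedTrap p p` or resolution of
singularities in dimension ≥ 4 / characteristic `p`.  AI kernel work, weaker than expert review.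

PLAN R1′ AT A ROTATION STEP.  The real chain takes chart `f` (the free letter) translating the slot letter `a` by
`τ′ = −ℓ_f/ℓ_a`; the two-slot game reads instead the SWAP PARTNER `B`, chart `a` translating `x_f` by `τ = 1/τ′ = −ℓ_a/ℓ_f` —
the case-S child that `slot_step_readings` already handles.  This file supplies what `slot_step_readings` asks of `B`:

* §1 the transition data (def-free, as hypotheses `hφf/hφa/hφi`, units `hea/hef/hei`): the SN1 transition IS a DIAGONAL unit-class substitution
  along `Equiv.swap a f` with units `e_a = x_f + τ`, `e_f = −τ′·P`, `e_i = P` (`P` an inverse of `x_f + τ` mod `x_f^M`,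
  `P(0) = τ′`): `swapSubst_diag`, `swapSubst_units`, `constantCoeff_inv_mod`.
* §2 **`rotation_partner_rel`** — `B.F = clean((x_f + τ)^p · θ(A.F)) + E`, `E ∈ 𝔪₀^M`, and `B.r = A.r ∘ (a f)`.
* §3 **`rotation_partner_readings`** (`p = 5`-free, any `p`): from `A` isolated with a certificate of level `N`,
  `ord₀ A.F = o` (`p ∤ o`), `x^{r_A} ∣ A.F`, power cone `resForm A = α·(Σ ℓᵢ xᵢ)^d` (`1 ≤ d < p`, `ℓ ≠ 0`), and `M > max(o, N + p)`:
  `ord₀ B.F = o`, `B` isolated, `e_G(B) = 3`, and `resForm B = α′·(Σ ℓ′ᵢ xᵢ)^d` with `ℓ′_f = −τ′²·ℓ_a` — so `B` sits in the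
  T-sector iff `A` does (`ℓ_a ≠ 0`: `a` is `A`'s free letter).

[cite: Hauser2010, §§F–G (chart expressions of a point blowup; cleaning)] [cite: CossartJannsenSaito2020, Def. 2.8, Def. 2.18]
bears_on: LADDER-RESOLUTION:D157-DOOR2 (res-dim4-pi · K2(p) · slice B · K24a-R1 partner).  Supports
stmt-ResolutionOfSingularities-16155 (helper).
-/

set_option linter.dupNamespace false -- mandated namespace of this single-conjunct summit

noncomputable section

namespace Summit.ResolutionOfSingularities.ResolutionOfSingularities.Theorems.PIDim4

namespace ResCone

open MvPolynomial Finset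
open Literature.AlgebraicGeometry.Resolution
open Literature.AlgebraicGeometry.Resolution.CentreBlowup
open Literature.AlgebraicGeometry.Resolution.Hauser2010
open Literature.AlgebraicGeometry.Resolution.HauserPerlega2019

variable {K : Type} [Field K]

/-! ## 1. The transition is diagonal -/

section Subst

variable {a f : Fin 4} {τ τ' : K} {M : ℕ} {P : MvPolynomial (Fin 4) K} {φ : Fin 4 → MvPolynomial (Fin 4) K}

/-- `P(0) = τ′` for an inverse `P` of `x_f + τ` modulo `x_f^M`, `M ≥ 1`, `τ τ′ = 1`. [folklore] -/
theorem constantCoeff_inv_mod (hττ' : τ * τ' = 1) (hM : 1 ≤ M)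
    (hP : (X f + C τ) * P - 1 ∈ Ideal.span {(X f : MvPolynomial (Fin 4) K) ^ M}) : constantCoeff P = τ' := by
  have h : constantCoeff ((X f + C τ) * P - 1) = 0 := by
    have h1 := ExceptionalLength.span_X_pow_le_originIdeal_pow f M hP
    exact (NarrowApolarity.mem_originIdeal_iff _).mp (Ideal.pow_le_self (by omega) h1)
  rw [map_sub, map_mul, map_add, constantCoeff_X, constantCoeff_C, zero_add, map_one, sub_eq_zero] at h
  have hτ : τ ≠ 0 := fun h0 => by rw [h0, zero_mul] at hττ'; exact zero_ne_one hττ'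
  calc constantCoeff P = τ' * (τ * constantCoeff P) := by rw [← mul_assoc, mul_comm τ', hττ', one_mul]
    _ = τ' := by rw [h, mul_one]

/-- **THE SN1 TRANSITION IS A DIAGONAL UNIT-CLASS SUBSTITUTION along `(a f)`**: `φ (swap a f · i) = x_i · e_i` with
`e_a = x_f + τ`, `e_f = −τ′ P`, `e_i = P` otherwise. [folklore] -/
theorem swapSubst_diag {e : Fin 4 → MvPolynomial (Fin 4) K} (hφf : φ f = X a * (X f + C τ))
    (hφa : φ a = -(C τ' * X f * P)) (hφi : ∀ i, i ≠ a → i ≠ f → φ i = X i * P) (hea : e a = X f + C τ)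
    (hef : e f = -(C τ' * P)) (hei : ∀ i, i ≠ a → i ≠ f → e i = P) (i : Fin 4) :
    φ (Equiv.swap a f i) = X i * e i := by
  by_cases hia : i = a
  · subst hia; rw [Equiv.swap_apply_left, hφf, hea]
  by_cases hif : i = f
  · subst hif; rw [Equiv.swap_apply_right, hφa, hef]; ring
  · rw [Equiv.swap_apply_of_ne_of_ne hia hif, hφi i hia hif, hei i hia hif]

/-- The units of the transition have the values `τ`, `−τ′²`, `τ′` at the origin — all non-zero. [folklore] -/
theorem swapSubst_units {e : Fin 4 → MvPolynomial (Fin 4) K} (haf : a ≠ f) (hττ' : τ * τ' = 1) (hM : 1 ≤ M)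
    (hP : (X f + C τ) * P - 1 ∈ Ideal.span {(X f : MvPolynomial (Fin 4) K) ^ M}) (hea : e a = X f + C τ)
    (hef : e f = -(C τ' * P)) (hei : ∀ i, i ≠ a → i ≠ f → e i = P) (i : Fin 4) :
    constantCoeff (e i) = (if i = a then τ else if i = f then -(τ' * τ') else τ') ∧ constantCoeff (e i) ≠ 0 := by
  have hP0 := constantCoeff_inv_mod hττ' hM hP
  have hτ : τ ≠ 0 := fun h0 => by rw [h0, zero_mul] at hττ'; exact zero_ne_one hττ'
  have hτ' : τ' ≠ 0 := fun h0 => by rw [h0, mul_zero] at hττ'; exact zero_ne_one hττ'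
  by_cases hia : i = a
  · subst hia
    rw [if_pos rfl, hea, map_add, constantCoeff_X, constantCoeff_C, zero_add]
    exact ⟨rfl, hτ⟩
  by_cases hif : i = f
  · subst hif
    rw [if_neg hia, if_pos rfl, hef, map_neg, map_mul, constantCoeff_C, hP0]
    exact ⟨rfl, neg_ne_zero.mpr (mul_ne_zero hτ' hτ')⟩
  · rw [if_neg hia, if_neg hif, hei i hia hif, hP0]
    exact ⟨rfl, hτ'⟩

end Subst

/-! ## 2. The relation between the rotation child and its swap partner -/

section Partner

variable (p : ℕ) [hp : Fact p.Prime] [CharP K p] [DecidableEq K]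

/-- **THE SWAP PARTNER IS A DIAGONAL RE-PRESENTATION OF THE ROTATION CHILD**: for a state `s` of order `≥ p`, letters
`a ≠ f`, `τ τ′ = 1` and every `M ≥ 1` there are a diagonal substitution `θ` along `(a f)` with units `e` (values `τ`, `−τ′²`,
`τ′` at `0`) and `E ∈ 𝔪₀^M` with `B.F = clean((x_f + τ)^p · θ(A.F)) + E` and `B.r = A.r ∘ (a f)`, where
`A = step_f(τ′ e_a) s`, `B = step_a(τ e_f) s`. [OURS · dress of SN1] [cite: Hauser2010, §§F–G] -/
theorem rotation_partner_rel {s : State K} (hF : (p : ℕ∞) ≤ ordAlong Finset.univ s.F) {a f : Fin 4} (haf : a ≠ f)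
    {τ τ' : K} (hττ' : τ * τ' = 1) {M : ℕ} (hM : 1 ≤ M) :
    ∃ (θ e : Fin 4 → MvPolynomial (Fin 4) K) (E : MvPolynomial (Fin 4) K),
      (∀ i, θ (Equiv.swap a f i) = X i * e i) ∧ (∀ i, constantCoeff (e i) ≠ 0) ∧
      (∀ i, constantCoeff (e i) = if i = a then τ else if i = f then -(τ' * τ') else τ') ∧
      E ∈ originIdeal K ^ M ∧
      (CentreBlowup.step p Finset.univ a (Pi.single f τ : Fin 4 → K) s).F =
        deletePthPowers p ((X f + C τ) ^ p *
          aeval θ (CentreBlowup.step p Finset.univ f (Pi.single a τ' : Fin 4 → K) s).F) + E ∧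
      (CentreBlowup.step p Finset.univ a (Pi.single f τ : Fin 4 → K) s).r =
        (CentreBlowup.step p Finset.univ f (Pi.single a τ' : Fin 4 → K) s).r.mapDomain (Equiv.swap a f).symm := by
  have hτ : τ ≠ 0 := fun h0 => by rw [h0, zero_mul] at hττ'; exact zero_ne_one hττ'
  have hτ' : τ' ≠ 0 := fun h0 => by rw [h0, mul_zero] at hττ'; exact zero_ne_one hττ'
  obtain ⟨P, hP⟩ := SwapNorm.exists_inv_mod_X_pow (K := K) f hτ M
  set φ : Fin 4 → MvPolynomial (Fin 4) K := fun i =>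
    if i = f then X a * (X f + C τ) else if i = a then -(C τ' * X f * P) else X i * P with hφ
  have hφf : φ f = X a * (X f + C τ) := by rw [hφ]; simp
  have hφa : φ a = -(C τ' * X f * P) := by rw [hφ]; simp [haf]
  have hφi : ∀ i, i ≠ a → i ≠ f → φ i = X i * P := fun i hia hif => by rw [hφ]; simp [hia, hif]
  set e : Fin 4 → MvPolynomial (Fin 4) K := fun i =>
    if i = a then X f + C τ else if i = f then -(C τ' * P) else P with he
  have hea : e a = X f + C τ := by rw [he]; simp
  have hef : e f = -(C τ' * P) := by rw [he]; simp [Ne.symm haf]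
  have hei : ∀ i, i ≠ a → i ≠ f → e i = P := fun i hia hif => by rw [he]; simp [hia, hif]
  have hrel := SwapNorm.swap_step_F_mem p hF haf hττ' hP hφf hφa hφi
  refine ⟨φ, e, (CentreBlowup.step p Finset.univ a (Pi.single f τ : Fin 4 → K) s).F -
      deletePthPowers p ((X f + C τ) ^ p * aeval φ (CentreBlowup.step p Finset.univ f (Pi.single a τ' : Fin 4 → K) s).F),
    swapSubst_diag hφf hφa hφi hea hef hei, fun i => (swapSubst_units haf hττ' hM hP hea hef hei i).2,
    fun i => (swapSubst_units haf hττ' hM hP hea hef hei i).1, ExceptionalLength.span_X_pow_le_originIdeal_pow f M hrel,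
    by rw [add_sub_cancel], ?_⟩
  ext i
  rw [mapDomain_symm_apply, SwapNorm.swap_step_r p haf hτ hτ' i]

/-! ## 3. What the two-slot game reads of the partner -/

/-- **THE SWAP PARTNER THROUGH THE GAME'S EYES** (K24a-R1′): with `A = step_f(τ′ e_a) s` ISOLATED with an isolation certificate of
level `N`, `ord₀ A.F = o`, `p ∤ o`, `x^{r_A} ∣ A.F`, residual cone `α·(Σ ℓᵢ xᵢ)^d` (`α ≠ 0`, `ℓ ≠ 0`, `1 ≤ d < p`), the partner
`B = step_a(τ e_f) s` has `ord₀ B.F = o`, is isolated, has `e_G = 3`, and its residual cone is `α′·(Σ ℓ′ᵢ xᵢ)^d` with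
`ℓ′_i = e_i(0)·ℓ_{(a f) i}` — in particular `ℓ′_f = −τ′²·ℓ_a`. [OURS] [cite: CossartJannsenSaito2020, Def. 2.8, Def. 2.18] -/
theorem rotation_partner_readings {s : State K} (hF : (p : ℕ∞) ≤ ordAlong Finset.univ s.F) {a f : Fin 4} (haf : a ≠ f)
    {τ τ' : K} (hττ' : τ * τ' = 1) {o N : ℕ}
    (hiso : IsIsolated p (CentreBlowup.step p Finset.univ f (Pi.single a τ' : Fin 4 → K) s).F)
    (hN : originIdeal K ^ N ≤ singLocusIdeal p (CentreBlowup.step p Finset.univ f (Pi.single a τ' : Fin 4 → K) s).F ⊔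
      originIdeal K ^ (N + 1))
    (ho : ordZero (CentreBlowup.step p Finset.univ f (Pi.single a τ' : Fin 4 → K) s).F = o) (hpo : ¬ p ∣ o)
    (hrA : ∀ d ∈ (CentreBlowup.step p Finset.univ f (Pi.single a τ' : Fin 4 → K) s).F.support,
      (CentreBlowup.step p Finset.univ f (Pi.single a τ' : Fin 4 → K) s).r ≤ d)
    {α : K} {ℓ : Fin 4 → K} {d : ℕ}
    (hform : resForm (CentreBlowup.step p Finset.univ f (Pi.single a τ' : Fin 4 → K) s) = C α * (∑ k, C (ℓ k) * X k) ^ d)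
    (hα : α ≠ 0) (hℓ : ℓ ≠ 0) (hd1 : 1 ≤ d) (hdp : d < p) :
    ordZero (CentreBlowup.step p Finset.univ a (Pi.single f τ : Fin 4 → K) s).F = o ∧
    IsIsolated p (CentreBlowup.step p Finset.univ a (Pi.single f τ : Fin 4 → K) s).F ∧
    Module.finrank K (resVertex (CentreBlowup.step p Finset.univ a (Pi.single f τ : Fin 4 → K) s)) = 3 ∧
    ∃ (α' : K) (ℓ' : Fin 4 → K), α' ≠ 0 ∧ ℓ' f = -(τ' * τ') * ℓ a ∧ (∀ i, i ≠ a → i ≠ f → ℓ' i = τ' * ℓ i) ∧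
      ℓ' a = τ * ℓ f ∧
      resForm (CentreBlowup.step p Finset.univ a (Pi.single f τ : Fin 4 → K) s) = C α' * (∑ i, C (ℓ' i) * X i) ^ d := by
  set A := CentreBlowup.step p Finset.univ f (Pi.single a τ' : Fin 4 → K) s with hA
  set B := CentreBlowup.step p Finset.univ a (Pi.single f τ : Fin 4 → K) s with hB
  -- the relation at a level past the order and the certificate
  set M := o + N + p + 1 with hM
  obtain ⟨θ, e, E, hθ, he, heval, hE, hrel, hrB⟩ := rotation_partner_rel p hF haf hττ' (M := M) (by omega)
  -- order and initial form (no inverse needed)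
  have hU : constantCoeff (X f + C τ : MvPolynomial (Fin 4) K) ≠ 0 := by
    rw [map_add, constantCoeff_X, constantCoeff_C, zero_add]
    exact fun h0 => by rw [h0, zero_mul] at hττ'; exact zero_ne_one hττ'
  obtain ⟨hoB, -⟩ := initialForm_of_diag_rel p hθ he hU hE hrel ho hpo (by omega)
  -- isolation through SN4a (`G = 0`)
  have hisoB : IsIsolated p B.F := by
    have hθf : θ (Equiv.swap a f f) = X f * e f + 0 := by rw [hθ, add_zero]
    exact (SwapNorm.read_of_rel p (π := Equiv.swap a f) (f := f) (fun i _ => hθ i) hθf he (map_zero _)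
      (coeff_zero _) hU hE hrel hiso hN (by omega) ho hpo (by omega)).1
  -- the power cone and `e_G`
  obtain ⟨α', hα', hres⟩ := resForm_powerCone_of_diag_rel p hθ he hU hE hrel ho hpo (by omega) hrA hrB hform hα
  have he3 := finrank_resVertex_of_diag_rel p hθ he hU hE hrel ho hpo (by omega) hrA hrB hform hα hℓ hd1 hdp
  refine ⟨hoB, hisoB, he3, α', fun i => constantCoeff (e i) * ℓ (Equiv.swap a f i), hα', ?_, ?_, ?_, hres⟩
  · show constantCoeff (e f) * ℓ (Equiv.swap a f f) = -(τ' * τ') * ℓ a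
    rw [heval, if_neg (Ne.symm haf), if_pos rfl, Equiv.swap_apply_right]
  · intro i hia hif
    show constantCoeff (e i) * ℓ (Equiv.swap a f i) = τ' * ℓ i
    rw [heval, if_neg hia, if_neg hif, Equiv.swap_apply_of_ne_of_ne hia hif]
  · show constantCoeff (e a) * ℓ (Equiv.swap a f a) = τ * ℓ f
    rw [heval, if_pos rfl, Equiv.swap_apply_left]

end Partner

end ResCone

end Summit.ResolutionOfSingularities.ResolutionOfSingularities.Theorems.PIDim4

end
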